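import Literature.NumberTheory.Transcendental.GammaIsoCrossTransfer
import Literature.NumberTheory.Transcendental.GammaIsoTwistedSteps
import HarnessLib

/-!
# Cross Γ-isomorphisms: the algebraic step (appending an element algebraic over the Γ-field)

M. Bays, J. Kirby, *Pseudo-exponential maps, variants, and quasiminimality*, Algebra & Number
Theory 12 (2018), §4.4 (proof of Thm 4.17, algebraic case) and Lemma 8.3 (proof, the reduction
"we may assume `A = A^full ∧ B`"): an isomorphism of Γ-fields `θ : ⟨K₁ c⟩ ≅ ⟨K₂ c'⟩` extends
over an element `x` algebraic over `⟨K₁ c⟩` by sending it to a root `x'` of `θ(minpoly x)`.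
The tree has this inside one field (`GammaField.IsGammaIso.exists_append_single_of_mem_acl`,
`GammaIsoAlgebraicStep.lean`; over an isomorphism of two bases of one field,
`GammaField.IsGammaIsoTw.exists_append_single_of_mem_acl`, `GammaIsoTwistedSteps.lean`). This file
is the CROSS-FIELD version (tuples `c` in `F₁`, `c'` in `F₂`, `GammaField.IsGammaIsoTw₂` of
`GammaIsoCross.lean`), a step of the cross-field `ℵ₀`-saturation needed for Zilber's
categoricity theorem:

* `IsGammaIsoTw₂.aeval_sumElim_single_eq_zero_iff` — same type at every level;
* `IsGammaIsoTw₂.append_single_of_minpoly` — relation form;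
* `IsGammaIsoTw₂.exists_append_single_of_mem_acl` — **the algebraic step across two fields**:
  for `F₂` algebraically closed, `c ↦ c'` a cross Γ-isomorphism over an isomorphism `σ` of base
  Γ-fields with `K₁ + ℚc ◁ F₁`, `K₂ + ℚc' ◁ F₂`, and `x ∉ K₁ + ℚc` algebraic over `⟨K₁ c⟩`, there
  is `x' ∉ K₂ + ℚc'` in `F₂`, algebraic over `⟨K₂ c'⟩`, with `(c, x) ↦ (c', x')` a cross
  Γ-isomorphism over `σ`.

Proofs: those of `GammaIsoTwistedSteps.lean`, verbatim with the two fields kept apart.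
Everything is proved.

## References

* M. Bays, J. Kirby, *Pseudo-exponential maps, variants, and quasiminimality*, Algebra & Number
  Theory 12 (2018) 493–549: §4.4 (Thm 4.17), Lemma 8.3, Def. 5.14.
-/

noncomputable section

open Set MvPolynomial

universe u

namespace Literature.NumberTheory.Transcendental

namespace GammaField

open Literature.ModelTheory.ExponentialFields.ExponentialRing ZilberHomogeneity

variable {F₁ : Type u} [Field F₁] [CharZero F₁] [Literature.ModelTheory.ExponentialFields.ExponentialRing F₁]
variable {F₂ : Type u} [Field F₂] [CharZero F₂] [Literature.ModelTheory.ExponentialFields.ExponentialRing F₂]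
variable {K₁ : Submodule ℚ F₁} {K₂ : Submodule ℚ F₂} {σ : fieldOf K₁ ≃+* fieldOf K₂} {N : ℕ}
  {c : Fin N → F₁} {c' : Fin N → F₂}

/-- **Same type at every level, over `σ`, across the two fields.** Let `θ : ⟨K₁ c⟩ ≅ ⟨K₂ c'⟩` be
the field isomorphism of a cross Γ-isomorphism `c ↦ c'`, `x ∈ F₁` integral over `⟨K₁ c⟩` with
minimal polynomial `q`, and `x' ∈ F₂` a root of `θ(q)`. Then for every level `M` and every
polynomial `P` over `K₁⁰`: `P(x, c, exp (c/M!)) = 0 ↔ P^σ(x', c', exp (c'/M!)) = 0`.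
[cite: BaysKirby2018ANT, §4.4 (Thm 4.17, proof)] -/
theorem IsGammaIsoTw₂.aeval_sumElim_single_eq_zero_iff (h : IsGammaIsoTw₂ σ c c') {x : F₁} {x' : F₂}
    (hxi : IsIntegral (IntermediateField.adjoin (fieldOf K₁) (allGens c)) x)
    (hx' : Polynomial.eval₂ ((algebraMap (IntermediateField.adjoin (fieldOf K₂) (allGens c')) F₂).comp
      h.fieldEquiv.toRingHom) x'
        (minpoly (IntermediateField.adjoin (fieldOf K₁) (allGens c)) x) = 0)
    (M : ℕ) (P : MvPolynomial (Fin 1 ⊕ (Fin N ⊕ Fin N)) (fieldOf K₁)) :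
    aeval (Sum.elim ![x] (lvGens M c)) P = 0 ↔
      aeval (Sum.elim ![x'] (lvGens M c')) (MvPolynomial.map (σ : fieldOf K₁ →+* fieldOf K₂) P) = 0 := by
  classical
  set E := IntermediateField.adjoin (fieldOf K₁) (allGens c) with hE
  set E' := IntermediateField.adjoin (fieldOf K₂) (allGens c') with hE'
  set θ : E ≃+* E' := h.fieldEquiv with hθ
  set q := minpoly E x with hq
  let v : Fin 1 ⊕ (Fin N ⊕ Fin N) → Polynomial E :=
    Sum.elim ![Polynomial.X] fun j => Polynomial.C ⟨lvGens M c j, lvGens_mem_adjoinField M c j⟩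
  let v' : Fin 1 ⊕ (Fin N ⊕ Fin N) → Polynomial E' :=
    Sum.elim ![Polynomial.X] fun j => Polynomial.C ⟨lvGens M c' j, lvGens_mem_adjoinField M c' j⟩
  let Φ : MvPolynomial (Fin 1 ⊕ (Fin N ⊕ Fin N)) (fieldOf K₁) →ₐ[fieldOf K₁] Polynomial E := aeval v
  let Φ' : MvPolynomial (Fin 1 ⊕ (Fin N ⊕ Fin N)) (fieldOf K₂) →ₐ[fieldOf K₂] Polynomial E' := aeval v'
  -- (α) evaluation compatibility
  have hα : ∀ P, ((Polynomial.aeval x (Φ P) : F₁)) = aeval (Sum.elim ![x] (lvGens M c)) P := by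
    intro P
    have : ((Polynomial.aeval x).restrictScalars (fieldOf K₁)).comp Φ =
        aeval (Sum.elim ![x] (lvGens M c)) := by
      refine MvPolynomial.algHom_ext fun i => ?_
      rcases i with i | j
      · simp [Φ, v, Fin.fin_one_eq_zero i]
      · simp [Φ, v]
    exact congrArg (fun f => f P) this
  have hα' : ∀ Q, ((Polynomial.aeval x' (Φ' Q) : F₂)) = aeval (Sum.elim ![x'] (lvGens M c')) Q := by
    intro Q
    have : ((Polynomial.aeval x').restrictScalars (fieldOf K₂)).comp Φ' =
        aeval (Sum.elim ![x'] (lvGens M c')) := by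
      refine MvPolynomial.algHom_ext fun i => ?_
      rcases i with i | j
      · simp [Φ', v', Fin.fin_one_eq_zero i]
      · simp [Φ', v']
    exact congrArg (fun f => f Q) this
  -- (β) `θ(P̃) = (P^σ)̃`
  have hθK : ∀ k : fieldOf K₁, θ (algebraMap (fieldOf K₁) E k) = algebraMap (fieldOf K₂) E' (σ k) := by
    intro k
    apply Subtype.ext
    exact h.coe_fieldEquiv_algebraMap k
  have hθg : ∀ j, θ ⟨lvGens M c j, lvGens_mem_adjoinField M c j⟩ =
      ⟨lvGens M c' j, lvGens_mem_adjoinField M c' j⟩ := by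
    intro j
    apply Subtype.ext
    exact h.coe_fieldEquiv_lvGens M j
  have hβ : ∀ P, (Φ P).map θ.toRingHom = Φ' (MvPolynomial.map (σ : fieldOf K₁ →+* fieldOf K₂) P) := by
    intro P
    have : (Polynomial.mapRingHom θ.toRingHom).comp Φ.toRingHom =
        Φ'.toRingHom.comp (MvPolynomial.map (σ : fieldOf K₁ →+* fieldOf K₂)) := by
      refine MvPolynomial.ringHom_ext (fun k => ?_) (fun i => ?_)
      · simp only [RingHom.comp_apply, AlgHom.toRingHom_eq_coe, RingHom.coe_coe, Polynomial.coe_mapRingHom,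
          Φ, Φ', MvPolynomial.aeval_C, Polynomial.algebraMap_apply, Polynomial.map_C, MvPolynomial.map_C]
        congr 1
        exact hθK k
      · rcases i with i | j
        · simp [Φ, Φ', v, v', Fin.fin_one_eq_zero i]
        · simp only [RingHom.comp_apply, AlgHom.toRingHom_eq_coe, RingHom.coe_coe,
            Polynomial.coe_mapRingHom, Φ, Φ', v, v', aeval_X, Sum.elim_inr, Polynomial.map_C,
            MvPolynomial.map_X]
          rw [show θ.toRingHom ⟨lvGens M c j, lvGens_mem_adjoinField M c j⟩ =
            ⟨lvGens M c' j, lvGens_mem_adjoinField M c' j⟩ from hθg j]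
    exact congrArg (fun f => f P) this
  -- (γ) `θ(q)` is the minimal polynomial of `x'`
  have hqirr : Irreducible q := minpoly.irreducible hxi
  have hqm : q.Monic := minpoly.monic hxi
  have hγ : minpoly E' x' = q.map θ.toRingHom := by
    symm
    refine minpoly.eq_of_irreducible_of_monic ?_ ?_ (hqm.map _)
    · have : Polynomial.mapEquiv θ q = q.map θ.toRingHom := Polynomial.mapEquiv_apply θ q
      rw [← this]
      exact (MulEquiv.irreducible_iff (Polynomial.mapEquiv θ)).2 hqirr
    · rw [Polynomial.aeval_def, Polynomial.eval₂_map]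
      exact hx'
  -- (δ) the chain of equivalences
  rw [← hα P, ← hα' (MvPolynomial.map (σ : fieldOf K₁ →+* fieldOf K₂) P)]
  rw [show ((Polynomial.aeval x (Φ P) : F₁)) = 0 ↔ Polynomial.aeval x (Φ P) = 0 from Iff.rfl,
    show ((Polynomial.aeval x' (Φ' (MvPolynomial.map (σ : fieldOf K₁ →+* fieldOf K₂) P)) : F₂)) = 0 ↔
      Polynomial.aeval x' (Φ' (MvPolynomial.map (σ : fieldOf K₁ →+* fieldOf K₂) P)) = 0 from Iff.rfl,
    ← minpoly.dvd_iff, ← minpoly.dvd_iff, hγ, ← hβ P, ← hq]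
  rw [show q.map θ.toRingHom = Polynomial.mapEquiv θ q from (Polynomial.mapEquiv_apply θ q).symm,
    show (Φ P).map θ.toRingHom = Polynomial.mapEquiv θ (Φ P) from (Polynomial.mapEquiv_apply θ _).symm,
    map_dvd_iff]

/-- **The algebraic step over `σ`, relation form, across the two fields**: with `θ`, `x ∈ F₁`
integral over `⟨K₁ c⟩` with `exp x` transcendental over `⟨K₁ c⟩(x)`, and `x' ∈ F₂` a root of
`θ(minpoly x)` with `exp x'` transcendental over `⟨K₂ c'⟩(x')`, `(c, x) ↦ (c', x')` is a cross
Γ-isomorphism over `σ`. [cite: BaysKirby2018ANT, §4.4 (Thm 4.17, proof)] -/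
theorem IsGammaIsoTw₂.append_single_of_minpoly (h : IsGammaIsoTw₂ σ c c') {x : F₁} {x' : F₂}
    (hxi : IsIntegral (IntermediateField.adjoin (fieldOf K₁) (allGens c)) x)
    (hx' : Polynomial.eval₂ ((algebraMap (IntermediateField.adjoin (fieldOf K₂) (allGens c')) F₂).comp
      h.fieldEquiv.toRingHom) x'
        (minpoly (IntermediateField.adjoin (fieldOf K₁) (allGens c)) x) = 0)
    (hex : exp x ∉ acl (insert x (gens (K₁ ⊔ Submodule.span ℚ (range c)))))
    (hex' : exp x' ∉ acl (insert x' (gens (K₂ ⊔ Submodule.span ℚ (range c'))))) :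
    IsGammaIsoTw₂ σ (Fin.append c ![x]) (Fin.append c' ![x']) := by
  intro M P
  have hp := algebraicIndependent_exp_div_factorial (K := K₁) (M := M) hex
  have hq := algebraicIndependent_exp_div_factorial (K := K₂) (M := M) hex'
  set ρ : Fin (N + 1) ⊕ Fin (N + 1) → Fin 1 ⊕ (Fin 1 ⊕ (Fin N ⊕ Fin N)) :=
    Sum.elim (Fin.addCases (fun i => Sum.inr (Sum.inr (Sum.inl i))) fun _ => Sum.inr (Sum.inl 0))
      (Fin.addCases (fun i => Sum.inr (Sum.inr (Sum.inr i))) fun _ => Sum.inl 0) with hρ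
  have e1 : aeval (lvGens M (Fin.append c ![x])) P =
      aeval (Sum.elim ![exp (x / (M.factorial : F₁))] (Sum.elim ![x] (lvGens M c))) (rename ρ P) := by
    rw [aeval_rename, ← lvGens_append_single_eq_comp]
  have e2 : aeval (lvGens M (Fin.append c' ![x'])) (MvPolynomial.map (σ : fieldOf K₁ →+* fieldOf K₂) P) =
      aeval (Sum.elim ![exp (x' / (M.factorial : F₂))] (Sum.elim ![x'] (lvGens M c')))
        (rename ρ (MvPolynomial.map (σ : fieldOf K₁ →+* fieldOf K₂) P)) := by
    rw [aeval_rename, ← lvGens_append_single_eq_comp]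
  rw [e1, e2, ← map_rename]
  exact aeval_sumElim_eq_zero_iff_map_of_forall₂ _ (fun Q => h.aeval_sumElim_single_eq_zero_iff hxi hx' M Q)
    hp hq _

/-- **The algebraic step over `σ`, across two fields** (cross-field form of
`IsGammaIsoTw.exists_append_single_of_mem_acl`; Bays–Kirby 2018, §4.4, proof of Thm 4.17,
algebraic case, and Lemma 8.3, proof). Let `F₂` be algebraically closed, `c ↦ c'` a cross
Γ-isomorphism over `σ` (an isomorphism of base Γ-fields) with `K₁ + ℚc ◁ F₁` and `K₂ + ℚc' ◁ F₂`,
and `x ∉ K₁ + ℚc` in `F₁` algebraic over the Γ-field `⟨K₁ c⟩`. Then there is `x' ∉ K₂ + ℚc'` in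
`F₂`, algebraic over `⟨K₂ c'⟩`, with `(c, x) ↦ (c', x')` a cross Γ-isomorphism over `σ`.
[cite: BaysKirby2018ANT, §4.4 (Thm 4.17, proof), Lemma 8.3 (proof), Def. 5.14] -/
theorem IsGammaIsoTw₂.exists_append_single_of_mem_acl [IsAlgClosed F₂]
    (h : IsGammaIsoTw₂ σ c c') (hσ : IsEBaseIso₂ K₁ K₂ σ)
    (hs : IsStrong (K₁ ⊔ Submodule.span ℚ (range c)))
    (hs' : IsStrong (K₂ ⊔ Submodule.span ℚ (range c'))) {x : F₁}
    (hx : x ∈ acl (gens (K₁ ⊔ Submodule.span ℚ (range c)))) (hxX : x ∉ K₁ ⊔ Submodule.span ℚ (range c)) :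
    ∃ x' : F₂, x' ∈ acl (gens (K₂ ⊔ Submodule.span ℚ (range c'))) ∧
      x' ∉ K₂ ⊔ Submodule.span ℚ (range c') ∧
      IsGammaIsoTw₂ σ (Fin.append c ![x]) (Fin.append c' ![x']) := by
  classical
  set E := IntermediateField.adjoin (fieldOf K₁) (allGens c) with hE
  set E' := IntermediateField.adjoin (fieldOf K₂) (allGens c') with hE'
  set θ : E ≃+* E' := h.fieldEquiv with hθ
  have hxi : IsIntegral E x := isIntegral_adjoinField_of_mem_acl hx
  set q := minpoly E x with hq
  set q' : Polynomial E' := q.map θ.toRingHom with hq'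
  have hqirr : Irreducible q := minpoly.irreducible hxi
  have hq'irr : Irreducible q' := by
    have : Polynomial.mapEquiv θ q = q' := Polynomial.mapEquiv_apply θ q
    rw [← this]
    exact (MulEquiv.irreducible_iff (Polynomial.mapEquiv θ)).2 hqirr
  have hdeg : (q'.map (algebraMap E' F₂)).degree ≠ 0 := by
    rw [Polynomial.degree_map]
    exact (Polynomial.degree_pos_of_irreducible hq'irr).ne'
  obtain ⟨x', hx'root⟩ := IsAlgClosed.exists_root _ hdeg
  have hx' : Polynomial.eval₂ ((algebraMap E' F₂).comp θ.toRingHom) x' q = 0 := by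
    rw [← Polynomial.eval₂_map, ← hq', ← Polynomial.eval_map]
    exact hx'root
  have hx'q' : Polynomial.aeval x' q' = 0 := by
    rw [Polynomial.aeval_def, hq', Polynomial.eval₂_map]; exact hx'
  have hx'alg : IsAlgebraic E' x' := ⟨q', hq'irr.ne_zero, hx'q'⟩
  have hx'acl : x' ∈ acl (gens (K₂ ⊔ Submodule.span ℚ (range c'))) := by
    rw [← acl_coe_adjoinField_eq K₂ c']
    exact mem_acl_coe_of_isAlgebraic E' hx'alg
  have hx'X : x' ∉ K₂ ⊔ Submodule.span ℚ (range c') := by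
    intro hx'X
    have hx'E : x' ∈ E' := mem_adjoinField_of_mem_sup hx'X
    have hroot : q'.IsRoot ⟨x', hx'E⟩ := by
      have h1 : algebraMap E' F₂ (Polynomial.aeval (⟨x', hx'E⟩ : E') q') = 0 := by
        rw [← Polynomial.aeval_algebraMap_apply F₂ (⟨x', hx'E⟩ : E') q']; exact hx'q'
      have h2 : Polynomial.aeval (⟨x', hx'E⟩ : E') q' = 0 :=
        (algebraMap E' F₂).injective (by rw [h1, map_zero])
      rwa [Polynomial.coe_aeval_eq_eval] at h2
    have hdeg1 : q'.degree = 1 := Polynomial.degree_eq_one_of_irreducible_of_root hq'irr hroot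
    have hdegq : q.degree = 1 := by
      rw [hq', Polynomial.degree_map] at hdeg1; exact hdeg1
    obtain ⟨e, he⟩ := minpoly.mem_range_of_degree_eq_one E x hdegq
    have hxe : x = (e : F₁) := he.symm
    have hqe : q = Polynomial.X - Polynomial.C e := by
      rw [hq, hxe]; exact minpoly.eq_X_sub_C (B := F₁) e
    have hx'e : x' = (θ e : F₂) := by
      have := hx'q'
      rw [hq', hqe, Polynomial.map_sub, Polynomial.map_X, Polynomial.map_C, map_sub, Polynomial.aeval_X,
        Polynomial.aeval_C, sub_eq_zero] at this
      exact this
    have hback : (h.fieldEquiv.symm ⟨x', hx'E⟩ : F₁) ∈ K₁ ⊔ Submodule.span ℚ (range c) := by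
      rw [h.coe_fieldEquiv_symm_eq, h.symm.coe_fieldEquiv_eq_transport hx'X]
      exact h.symm.transport_mem hσ.symm hx'X
    have hsymm : h.fieldEquiv.symm ⟨x', hx'E⟩ = e := by
      apply h.fieldEquiv.injective
      rw [RingEquiv.apply_symm_apply]
      exact Subtype.ext hx'e
    rw [hsymm, ← hxe] at hback
    exact hxX hback
  refine ⟨x', hx'acl, hx'X, h.append_single_of_minpoly hxi hx' ?_ ?_⟩
  · exact exp_not_mem_acl_of_mem_acl hs hx hxX
  · exact exp_not_mem_acl_of_mem_acl hs' hx'acl hx'X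

end GammaField

end Literature.NumberTheory.Transcendental
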